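import Literature.NumberTheory.LFunctions.SuzukiWeilNormIdentityProofs
import Literature.NumberTheory.LFunctions.RiemannXiHadamardProduct
import Literature.NumberTheory.LFunctions.ZetaLogDerivRePartialFraction
import Literature.NumberTheory.LFunctions.XiModulusMonotone
import HarnessLib

/-!
# Completeness of Suzuki's family `ψ_γ` in `V(0)` (CJM Prop. 4.1, de Branges' Thm. 22 for `E_ξ`) and the discharge of `Suzuki2025_orthogonalBasis`, `Suzuki2025_thm55_normIdentity`

LINE 1 — LABEL: RH-CONSEQUENCE proofs (every theorem about the zeros carries the explicit binder
`RiemannHypothesis →`, never dropped) about the RH-EQUIVALENT·PRINTED residual `IsolatedV0` of the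
cell rh-crit/dbl (M. Suzuki, *On the Hilbert space derived from the Weil distribution*, Canad. J.
Math. 2025 = arXiv:2301.00421v3, Prop. 4.1, Thm. 5.5 (1), Prop. 5.8). bears_on: B-C/B-P (LADDER-RH
COLUMN 6 DBR). WHAT THIS IS NOT: proving the printed RH-CONSEQUENCES behind Suzuki's door fixes the
kernel status of the RH-EQUIVALENT criterion (both directions of CJM Prop. 5.8 become theorems:
`RH ⟺ IsolatedV0`); it does not move RH; nothing here bears on the truth of RH.

## What is proved (under the RH binder unless marked RH-FREE)

The completeness clause of CJM Prop. 4.1 ("the family (3.5) forms an orthonormal BASIS of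
`𝒦(Θ)`"), printed proof [Su23b] Prop. 3.2: "`A(iy)/E(iy) ≫ (log y)⁻¹` … shows that `A ∉ 𝓗(E)`
by [Re02, Prop. 2.1]. Therefore the family `{A(z)/(z−γ)}` forms an orthogonal basis of `𝓗(E)` by
[dB68, Theorem 22]". We follow this proof's CONTENT in the form that the tree supports: de
Branges' Thm. 22 says the `K(γ, ·)`, `A(γ) = 0`, span `𝓗(E)` up to the one function `A`, and
`A ∉ 𝓗(E)` is the absence of a linear term ("mass at infinity") in the Nevanlinna expansion of
`B/A = iξ′/ξ(½ − iz)`; for `E = E_ξ` that expansion IS the Hadamard partial fraction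
`ξ′/ξ(s) = Σ_ρ 1/(s−ρ)` (pairs `ρ ↔ 1−ρ`) PROVED in the tree (`RiemannXiHadamardProduct`), whose
pairing has no linear term. Concretely:

* §A the symbol `Θ_ξ` continued to the CLOSED upper half-plane (`exists_lagariasTheta_continuation`:
  removable singularities at the real zeros of `E_ξ`, `|Θ₁| ≤ 1`), the inner-function Cauchy
  identity `∫ Θ(x)dx/((x−z)(x−w̄)) = 2πiΘ(z)/(z−w̄)` (`inner_fourier_cauchyVec_thetaMul`) and
  `Θ·𝖥e_w ∈ H²` (`thetaMul_fourier_cauchyVec_mem_hardyL2`) by the tree's half-plane Cauchy /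
  Paley–Wiener-by-duality theorems; hence `K_w ∈ H²` and the kernel values
  `(2π)⁻¹⟪𝖥e_z, K_w⟫ = (i/2π)(1 − conj Θ(w)Θ(z))/(z − w̄)` (`inner_fourier_cauchyVec_modelKernelVec`);
* §B the Hadamard partial fraction over the subtype of zeros with multiplicity (RH-FREE where
  possible): `Σ_ρ m_ρ/((γ_ρ−z)(γ_ρ−w̄)) = (M(z) − M(w̄))/(z − w̄)`, `M(u) := iξ′/ξ(½−iu)`
  (`hasSum_zeroOrder_div_kernelPair`), and `(1+Θ(z))(1+conj Θ(w))(M(z) − M(w̄)) =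
  2i(1 − Θ(z)conj Θ(w))` (`kernel_numerator_identity`);
* §C the orthonormal family `f_ρ = 𝖥ψ_ρ` of the cell's `SuzukiWeilOrthogonalSetProofs` with its
  half-plane values `ψ̂_ρ = F_ρ` on `ℂ₊` (`exists_suzukiFamily`), the **kernel expansion
  `K_w = Σ_ρ conj F_ρ(w)·f_ρ`**, i.e. `K_w ∈ closure span{f_ρ}`
  (`modelKernelVec_mem_topologicalClosure_span`: the projection `P_W K_w` has the same pairings
  with all Cauchy kernels as `K_w`, by §B), hence COMPLETENESS
  (`eq_zero_of_forall_inner_family_eq_zero`);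
* §D the discharges **`Suzuki2025_orthogonalBasis_holds`** and
  **`Suzuki2025_thm55_normIdentity_holds`** (the latter with the cell's
  `Suzuki2025_thm55_normIdentity_of_orthogonalBasis`). No named fact is introduced.
* §E CJM Lemma 5.3 (`V(0) ≅ L²(τ)`: values exist, the isometry (5.5), surjectivity by orthogonal
  expansion along `ψ_γ`) — the discharge **`Suzuki2025_lemma53_holds`**.

## References
* M. Suzuki, Canad. J. Math. 2025 = arXiv:2301.00421v3, Prop. 4.1 p. 10 (TeX l.1120–1142),
  Thm. 5.5 (1) p. 15 (TeX l.1676–1757), §2.3–2.4 p. 5. [Suzuki2025WeilHilbertSpace]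
* M. Suzuki, J. Number Theory 252 (2023), Prop. 3.2 and its proof (the printed source of Prop. 4.1).
  [Suzuki2023b]
* L. de Branges, *Hilbert spaces of entire functions* (1968), Thm. 22. [cited via Suzuki2023b]
-/

noncomputable section

open MeasureTheory Complex Filter Set FourierTransform
open scoped ComplexConjugate FourierTransform Topology Real ENNReal InnerProductSpace

namespace Literature.NumberTheory.LFunctions

open ZetaZeros Literature.Analysis.DeBrangesSpaces Literature.Analysis.Fourier

/-! ## A. `Θ_ξ` on the closed upper half-plane, the inner-function identity, `K_w ∈ H²` -/

/-- Under RH, `A(z) = ξ(½ − iz) ≠ 0` on the open upper half-plane (`Re(½ − iz) = ½ + Im z`).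
RH-CONSEQUENCE. [cite: Suzuki2025WeilHilbertSpace, CJM §1 p. 2 ("Γ … the set of all zeros of ξ(1/2 − iz)")] -/
theorem lagariasXiA_ne_zero_of_im_pos (hRH : RiemannHypothesis) {z : ℂ} (hz : 0 < z.im) :
    lagariasXiA z ≠ 0 := by
  rw [lagariasXiA_eq]
  refine SondowDumitrescu2010.riemannXi_ne_zero_of_RH hRH ?_
  simp only [Complex.sub_re, Complex.mul_re, Complex.I_re, Complex.I_im, one_div]
  norm_num
  linarith

/-- **`Θ_ξ` continued to the closed upper half-plane (under RH).** There is `Θ₁`, complex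
differentiable at every point of `{Im z ≥ 0}`, equal to `Θ_ξ` wherever `E_ξ ≠ 0` (so on `ℂ₊` and
a.e. on `ℝ`), with `|Θ₁| ≤ 1` on `{Im z ≥ 0}`: the real zeros of `E_ξ` are removable for `Θ_ξ`
(the cell's RH-free germ lemma `exists_analyticAt_lagariasTheta_germ`) and `|Θ_ξ| < 1` on `ℂ₊`
([La06] Thm. 1). This is "`Θ` is a meromorphic inner function in `ℂ₊`" (CJM §4.1) in the form the
half-plane Cauchy theorems of the tree consume. RH-CONSEQUENCE.
[cite: Suzuki2025WeilHilbertSpace, CJM §4.1 p. 10 (TeX l.1113–1117: "E = E_ξ belongs to the Hermite–Biehler class … and thus Θ = Θ_ξ is a meromorphic inner function")] -/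
theorem exists_lagariasTheta_continuation (hRH : RiemannHypothesis) :
    ∃ Θ₁ : ℂ → ℂ, (∀ z : ℂ, 0 ≤ z.im → DifferentiableAt ℂ Θ₁ z) ∧
      (∀ z : ℂ, lagariasE z ≠ 0 → Θ₁ z = lagariasTheta z) ∧
      (∀ z : ℂ, 0 ≤ z.im → ‖Θ₁ z‖ ≤ 1) := by
  classical
  have hE := Lagarias2006_thm1_onlyif_holds hRH
  set Θ₁ : ℂ → ℂ := fun z ↦ if lagariasE z = 0 then limUnder (𝓝[≠] z) lagariasTheta
    else lagariasTheta z with hΘ₁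
  have hΘ₁eq : ∀ z : ℂ, lagariasE z ≠ 0 → Θ₁ z = lagariasTheta z := fun z hz ↦ by
    simp only [hΘ₁, hz, if_false]
  -- differentiability at the points of the closed upper half-plane
  have hdiff : ∀ z : ℂ, 0 ≤ z.im → DifferentiableAt ℂ Θ₁ z := by
    intro z hz
    by_cases hEz : lagariasE z = 0
    · -- a real zero of `E`: use the analytic germ
      have hzreal : z.im = 0 := by
        rcases hz.lt_or_eq with h | h
        · exact absurd hEz (hE.ne_zero_of_im_pos h)
        · exact h.symm
      have hzeq : ((z.re : ℝ) : ℂ) = z := Complex.ext (by simp) (by simp [hzreal])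
      obtain ⟨q, hq, hΘq, -⟩ := exists_analyticAt_lagariasTheta_germ z.re
      rw [hzeq] at hq hΘq
      have hEne : ∀ᶠ u in 𝓝[≠] z, lagariasE u ≠ 0 :=
        ((differentiable_lagariasE.analyticAt z).eventually_eq_zero_or_eventually_ne_zero).resolve_left
          fun h ↦ analyticOrderAt_lagariasE_ne_top z (analyticOrderAt_eq_top.2 h)
      have hlim : Tendsto lagariasTheta (𝓝[≠] z) (𝓝 (q z)) :=
        (hq.continuousAt.tendsto.mono_left nhdsWithin_le_nhds).congr' (hΘq.mono fun u hu ↦ hu.symm)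
      have hval : Θ₁ z = q z := by
        simp only [hΘ₁, hEz, if_true]
        exact hlim.limUnder_eq
      have hloc : Θ₁ =ᶠ[𝓝 z] q := by
        have h1 : ∀ᶠ u in 𝓝 z, u ≠ z → (lagariasE u ≠ 0 ∧ lagariasTheta u = q u) :=
          eventually_nhdsWithin_iff.1 (hEne.and hΘq)
        filter_upwards [h1] with u hu
        by_cases huz : u = z
        · rw [huz]; exact hval
        · obtain ⟨hEu, hqu⟩ := hu huz
          rw [hΘ₁eq u hEu, hqu]
      exact hq.differentiableAt.congr_of_eventuallyEq hloc
    · have hne : ∀ᶠ u in 𝓝 z, lagariasE u ≠ 0 :=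
        differentiable_lagariasE.continuous.continuousAt.eventually_ne hEz
      have hloc : Θ₁ =ᶠ[𝓝 z] lagariasTheta := by
        filter_upwards [hne] with u hu
        exact hΘ₁eq u hu
      have hd : DifferentiableAt ℂ lagariasTheta z :=
        ((differentiable_sharp differentiable_lagariasE) z).div (differentiable_lagariasE z) hEz
      exact hd.congr_of_eventuallyEq hloc
  refine ⟨Θ₁, hdiff, hΘ₁eq, fun z hz ↦ ?_⟩
  rcases hz.lt_or_eq with h | h
  · rw [hΘ₁eq z (lagariasE_ne_zero_of_im_pos hRH h)]
    exact norm_lagariasTheta_le_one_of_im_pos hRH h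
  · -- on the real line: limit of values of norm `≤ 1` along `z + iy`, `y ↓ 0`
    have hcont : Tendsto (fun y : ℝ ↦ Θ₁ (z + I * y)) (𝓝[>] 0) (𝓝 (Θ₁ z)) := by
      have h1 : Tendsto (fun y : ℝ ↦ z + I * y) (𝓝 0) (𝓝 z) := by
        have : Tendsto (fun y : ℝ ↦ z + I * y) (𝓝 0) (𝓝 (z + I * (0 : ℝ))) :=
          (continuous_const.add (continuous_const.mul Complex.continuous_ofReal)).tendsto 0
        rwa [Complex.ofReal_zero, mul_zero, add_zero] at this
      exact ((hdiff z hz).continuousAt.tendsto.comp h1).mono_left nhdsWithin_le_nhds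
    refine le_of_tendsto hcont.norm ?_
    filter_upwards [self_mem_nhdsWithin] with y hy
    have him : 0 < (z + I * y).im := by simp [← h]; exact hy
    rw [hΘ₁eq _ (lagariasE_ne_zero_of_im_pos hRH him)]
    exact norm_lagariasTheta_le_one_of_im_pos hRH him

/-- The function `g_w(ζ) := Θ₁(ζ)/(ζ − w̄)` (plumbing for the Cauchy / Paley–Wiener hypotheses):
differentiable on the closed upper half-plane, square-integrable on `ℝ`, and `≤ 2/√(Im ζ)` far
out. [folklore] -/
private theorem cauchyTheta_hypotheses (hRH : RiemannHypothesis) {Θ₁ : ℂ → ℂ}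
    (hd : ∀ z : ℂ, 0 ≤ z.im → DifferentiableAt ℂ Θ₁ z) (hb : ∀ z : ℂ, 0 ≤ z.im → ‖Θ₁ z‖ ≤ 1)
    {w : ℂ} (hw : 0 < w.im) :
    (∀ z : ℂ, 0 ≤ z.im → DifferentiableAt ℂ (fun ζ ↦ Θ₁ ζ / (ζ - conj w)) z) ∧
    (Integrable fun x : ℝ ↦ ‖(fun ζ : ℂ ↦ Θ₁ ζ / (ζ - conj w)) x‖ ^ 2) ∧
    (∀ z : ℂ, 0 < z.im → max 1 (2 * ‖w‖) ≤ ‖z‖ →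
      ‖(fun ζ : ℂ ↦ Θ₁ ζ / (ζ - conj w)) z‖ ≤ 2 / √z.im) := by
  have _ := hRH
  have hden : ∀ z : ℂ, 0 ≤ z.im → z - conj w ≠ 0 := by
    intro z hz h
    have := congrArg Complex.im h
    simp only [Complex.sub_im, Complex.conj_im, Complex.zero_im] at this
    linarith
  refine ⟨fun z hz ↦ (hd z hz).div
    ((differentiableAt_id).sub (differentiableAt_const _)) (hden z hz), ?_, ?_⟩
  · -- `‖g(x)‖² ≤ 1/((x − Re w)² + (Im w)²)`
    have hcont : Continuous fun x : ℝ ↦ Θ₁ x / ((x : ℂ) - conj w) := by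
      have h1 : ∀ x : ℝ, ContinuousAt (fun ζ : ℂ ↦ Θ₁ ζ / (ζ - conj w)) (x : ℂ) := fun x ↦
        ((hd x (by simp)).div
          ((differentiableAt_id).sub (differentiableAt_const _)) (hden x (by simp))).continuousAt
      exact continuous_iff_continuousAt.2 fun x ↦ (h1 x).comp Complex.continuous_ofReal.continuousAt
    refine Integrable.mono' (integrable_inv_sub_sq_add_sq w.re hw.ne')
      (hcont.norm.pow 2).aestronglyMeasurable (Eventually.of_forall fun x ↦ ?_)
    rw [Real.norm_of_nonneg (by positivity), norm_div, div_pow]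
    have hxw : ‖(x : ℂ) - conj w‖ ^ 2 = (x - w.re) ^ 2 + w.im ^ 2 := by
      rw [Literature.Analysis.DeBrangesSpaces.norm_ofReal_sub_sq]
      simp
    rw [hxw]
    have h1 : ‖Θ₁ x‖ ^ 2 ≤ 1 := by
      have := hb x (by simp)
      exact pow_le_one₀ (norm_nonneg _) this
    have hpos : 0 < (x - w.re) ^ 2 + w.im ^ 2 := by positivity
    calc ‖Θ₁ ↑x‖ ^ 2 / ((x - w.re) ^ 2 + w.im ^ 2) ≤ 1 / ((x - w.re) ^ 2 + w.im ^ 2) := by gcongr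
      _ = ((x - w.re) ^ 2 + w.im ^ 2)⁻¹ := one_div _
  · intro z hz hR
    have h1 : (1 : ℝ) ≤ ‖z‖ := (le_max_left _ _).trans hR
    have h2 : 2 * ‖w‖ ≤ ‖z‖ := (le_max_right _ _).trans hR
    have hzw : ‖z‖ / 2 ≤ ‖z - conj w‖ := by
      have := norm_sub_norm_le z (conj w)
      rw [Complex.norm_conj] at this
      linarith
    have hzpos : 0 < ‖z‖ := by linarith
    have hsqrt : √z.im ≤ ‖z‖ := sqrt_im_le_norm h1
    have hsqrt0 : 0 < √z.im := Real.sqrt_pos.2 hz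
    rw [norm_div]
    calc ‖Θ₁ z‖ / ‖z - conj w‖ ≤ 1 / (‖z‖ / 2) :=
          div_le_div₀ zero_le_one (hb z hz.le) (by positivity) hzw
      _ = 2 / ‖z‖ := by field_simp
      _ ≤ 2 / √z.im := by gcongr

/-- **The inner-function Cauchy identity (under RH):** for `z, w ∈ ℂ₊`,
`⟪𝖥e_z, Θ_ξ·𝖥e_w⟫ = Θ_ξ(z)·⟪𝖥e_z, 𝖥e_w⟫`, i.e. `∫ Θ_ξ(x)dx/((x−z)(x−w̄)) = 2πiΘ_ξ(z)/(z−w̄)` —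
Cauchy's formula along `ℝ` (the tree's `integral_div_sub_eq_of_im_pos`) for `Θ₁(ζ)/(ζ − w̄)`,
holomorphic on the closed upper half-plane with `L²` trace. This is the one place where "`Θ` is
inner" (`ΘH² ⊆ H²` with `(ΘG)(z) = Θ(z)G(z)`) enters the completeness argument. RH-CONSEQUENCE.
[cite: Suzuki2025WeilHilbertSpace, CJM §2.4 p. 5 (TeX l.686–700: "inner function … ΘH² = {Θ(z)F(z) | F ∈ H²}") and §4.1 p. 10 (TeX l.1113–1117)] -/
theorem inner_fourier_cauchyVec_thetaMul (hRH : RiemannHypothesis) {z w : ℂ} (hz : 0 < z.im)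
    (hw : 0 < w.im) :
    inner ℂ (suzukiFourierL2 (cauchyVec z)) (thetaMul (suzukiFourierL2 (cauchyVec w))) =
      lagariasTheta z * inner ℂ (suzukiFourierL2 (cauchyVec z)) (suzukiFourierL2 (cauchyVec w)) := by
  obtain ⟨Θ₁, hd, heq, hb⟩ := exists_lagariasTheta_continuation hRH
  obtain ⟨hgd, hgi, hgb⟩ := cauchyTheta_hypotheses hRH hd hb hw
  have hC := integral_div_sub_eq_of_im_pos (g := fun ζ : ℂ ↦ Θ₁ ζ / (ζ - conj w))
    (by norm_num : (0 : ℝ) ≤ 2) hgd hgi hgb hz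
  -- the inner product as the same integral
  rw [inner_fourier_cauchyVec hz hw, inner_L2_eq_integral]
  have hzne : ∀ x : ℝ, (x : ℂ) - z ≠ 0 := fun x h ↦ by
    have := congrArg Complex.im h; simp at this; linarith
  have hae : (fun x : ℝ ↦ conj ((suzukiFourierL2 (cauchyVec z) : ℝ → ℂ) x) *
      (thetaMul (suzukiFourierL2 (cauchyVec w)) : ℝ → ℂ) x) =ᵐ[volume]
      fun x : ℝ ↦ (fun ζ : ℂ ↦ Θ₁ ζ / (ζ - conj w)) x / (x - z) := by
    filter_upwards [suzukiFourierL2_cauchyVec hz, coeFn_thetaMul (suzukiFourierL2 (cauchyVec w)),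
      suzukiFourierL2_cauchyVec hw, ae_lagariasE_ofReal_ne_zero] with x h1 h2 h3 hE
    rw [h1, h2, h3, heq x hE]
    have hc : conj (I / ((x : ℂ) - conj z)) = -I / ((x : ℂ) - z) := by
      rw [map_div₀, Complex.conj_I, map_sub, Complex.conj_ofReal, Complex.conj_conj]
    rw [hc]
    have hzw : (x : ℂ) - conj w ≠ 0 := fun h ↦ by
      have := congrArg Complex.im h; simp at this; linarith [hw]
    field_simp
    rw [Complex.I_sq]; ring
  rw [integral_congr_ae hae, hC, heq z (lagariasE_ne_zero_of_im_pos hRH hz)]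
  have hzw : z - conj w ≠ 0 := fun h ↦ by
    have := congrArg Complex.im h; simp at this; linarith
  field_simp

/-- `𝖥(𝓕⁻¹[g(−2π·)]) = g` on the line (Suzuki's `𝖥` versus Mathlib's `𝓕⁻`: `𝖥ψ(u) = (𝓕⁻ψ)(u/2π)`
and `𝓕⁻𝓕⁻G = G(−·)`). RH-FREE bookkeeping. [cite: Suzuki2025WeilHilbertSpace, CJM eq. (1.1) p. 2 and §2.3 p. 5 (TeX l.615–619)] -/
theorem suzukiFourierL2_fourierInv_dilate {g : ℝ → ℂ}
    (hg : MemLp (fun ξ : ℝ ↦ g (-(2 * π) * ξ)) 2 volume) :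
    (suzukiFourierL2 (𝓕⁻ (hg.toLp _ : Lp ℂ 2 (volume : Measure ℝ)) : Lp ℂ 2 (volume : Measure ℝ))
        : ℝ → ℂ) =ᵐ[volume] g := by
  set F₀ : Lp ℂ 2 (volume : Measure ℝ) := hg.toLp _ with hF₀
  have hc : (2 * Real.pi)⁻¹ ≠ 0 := inv_ne_zero Real.two_pi_pos.ne'
  have hq := (measurePreserving_mul_left hc).quasiMeasurePreserving.mono_right
    Measure.smul_absolutelyContinuous
  have hqn : Measure.QuasiMeasurePreserving (fun x : ℝ => -x) volume volume :=
    (Measure.measurePreserving_neg (volume : Measure ℝ)).quasiMeasurePreserving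
  -- `𝓕⁻ (𝓕⁻ F₀) = R F₀ = g(2π ·)` a.e.
  have h1 : ((𝓕⁻ (𝓕⁻ F₀ : Lp ℂ 2 (volume : Measure ℝ)) : Lp ℂ 2 (volume : Measure ℝ)) : ℝ → ℂ)
      =ᵐ[volume] fun y : ℝ ↦ g (2 * π * y) := by
    rw [fourierInv_fourierInv_eq_compNeg]
    filter_upwards [coeFn_compNeg F₀, hqn.ae (MemLp.coeFn_toLp hg)] with y e1 e2
    rw [e1, e2]
    congr 1; ring
  filter_upwards [coeFn_suzukiFourierL2 (𝓕⁻ F₀ : Lp ℂ 2 (volume : Measure ℝ)), hq.ae h1] with u e1 e2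
  rw [e1, e2]
  congr 1
  field_simp

/-- **`Θ_ξ·𝖥e_w ∈ H²` (under RH)** for `w ∈ ℂ₊`: the boundary function `x ↦ iΘ_ξ(x)/(x − w̄)` is the
trace of `iΘ₁(ζ)/(ζ − w̄)`, holomorphic on the closed upper half-plane with `L²` trace and decay,
hence the transform of an `L²(0,∞)` function by Paley–Wiener-by-duality (the tree's
`fourierInv_ae_eq_zero_of_neg`). The operational content of "`ΘH² ⊆ H²` for inner `Θ`" on the
Cauchy kernels. RH-CONSEQUENCE. [cite: Suzuki2025WeilHilbertSpace, CJM §2.4 p. 5 (TeX l.686–700: "ΘH² … forms a closed subspace of H²")] -/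
theorem thetaMul_fourier_cauchyVec_mem_hardyL2 (hRH : RiemannHypothesis) {w : ℂ} (hw : 0 < w.im) :
    thetaMul (suzukiFourierL2 (cauchyVec w)) ∈ hardyL2 := by
  obtain ⟨Θ₁, hd, heq, hb⟩ := exists_lagariasTheta_continuation hRH
  obtain ⟨hgd, hgi, hgb⟩ := cauchyTheta_hypotheses hRH hd hb hw
  set g : ℂ → ℂ := fun ζ ↦ Θ₁ ζ / (ζ - conj w) with hg
  have hG2 : MemLp (fun ξ : ℝ ↦ g ((-(2 * π) * ξ : ℝ) : ℂ)) 2 volume := memLp_two_boundary_dilate hgd hgi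
  set ψ₀ : Lp ℂ 2 (volume : Measure ℝ) := 𝓕⁻ (hG2.toLp _ : Lp ℂ 2 (volume : Measure ℝ)) with hψ₀
  have hψ₀mem : ψ₀ ∈ halfLineL2 0 :=
    fourierInv_ae_eq_zero_of_neg (by norm_num : (0 : ℝ) ≤ 2) hgd hgi hgb hG2
  have hF : thetaMul (suzukiFourierL2 (cauchyVec w)) = I • suzukiFourierL2 ψ₀ := by
    refine Lp.ext ?_
    filter_upwards [suzukiFourierL2_fourierInv_dilate (g := fun x : ℝ ↦ g x) hG2,
      coeFn_thetaMul (suzukiFourierL2 (cauchyVec w)), suzukiFourierL2_cauchyVec hw,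
      ae_lagariasE_ofReal_ne_zero, Lp.coeFn_smul I (suzukiFourierL2 ψ₀)] with x h1 h2 h3 hE h4
    rw [h4, Pi.smul_apply, h1, h2, h3, hg, smul_eq_mul]
    simp only
    rw [heq x hE]
    ring
  rw [hF]
  exact smul_mem_hardyL2 I ((suzukiFourierL2_mem_hardyL2_iff ψ₀).2 hψ₀mem)

/-- **`K_w ∈ H²` (under RH)**, `w ∈ ℂ₊` (`𝖥e_w ∈ H²` RH-free, `Θ·𝖥e_w ∈ H²` above, `H²` a subspace).
RH-CONSEQUENCE. [cite: Suzuki2025WeilHilbertSpace, CJM §2.4 p. 5 (TeX l.689–700: "𝒦(Θ) = H² ⊖ ΘH²")] -/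
theorem modelKernelVec_mem_hardyL2 (hRH : RiemannHypothesis) {w : ℂ} (hw : 0 < w.im) :
    modelKernelVec w ∈ hardyL2 := by
  unfold modelKernelVec
  refine smul_mem_hardyL2 _ ?_
  rw [sub_eq_add_neg, ← neg_smul]
  exact add_mem_hardyL2 (suzukiFourierL2_cauchyVec_mem_hardyL2 hw)
    (smul_mem_hardyL2 _ (thetaMul_fourier_cauchyVec_mem_hardyL2 hRH hw))

/-- **The kernel values (under RH):** `⟪𝖥e_z, K_w⟫ = i(1 − conj Θ_ξ(w)Θ_ξ(z))/(z − w̄)` for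
`z, w ∈ ℂ₊`, i.e. `(2π)⁻¹⟪𝖥e_z, K_w⟫ = K_w(z)` is the model-space kernel `(i/2π)(1 − Θ̄(w)Θ(z))/(z − w̄)`
evaluated in the upper half-plane (from `⟪𝖥e_z, 𝖥e_w⟫ = 2πi/(z−w̄)` and the inner-function
identity). RH-CONSEQUENCE. [cite: Suzuki2025WeilHilbertSpace, CJM §2.4 p. 5 (TeX l.689–705)] -/
theorem inner_fourier_cauchyVec_modelKernelVec (hRH : RiemannHypothesis) {z w : ℂ} (hz : 0 < z.im)
    (hw : 0 < w.im) :
    inner ℂ (suzukiFourierL2 (cauchyVec z)) (modelKernelVec w) =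
      I * (1 - conj (lagariasTheta w) * lagariasTheta z) / (z - conj w) := by
  unfold modelKernelVec
  rw [inner_smul_right, inner_sub_right, inner_smul_right,
    inner_fourier_cauchyVec_thetaMul hRH hz hw, inner_fourier_cauchyVec hz hw]
  have hzw : z - conj w ≠ 0 := fun h ↦ by
    have := congrArg Complex.im h; simp at this; linarith
  have hπ : (Real.pi : ℂ) ≠ 0 := Complex.ofReal_ne_zero.2 Real.pi_ne_zero
  field_simp

/-! ## B. The Hadamard partial fraction behind the kernel expansion -/

/-- `M(u) := i·ξ′/ξ(½ − iu)` — the logarithmic derivative of `A(u) = ξ(½ − iu)` up to sign (it is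
`B/A` for `E_ξ = A − iB`, a Nevanlinna function on `ℂ₊` under RH). RH-FREE object.
[cite: Suzuki2023b, Prop. 3.2 (proof), p. 8 ("A(iy)/E(iy) = (1 − … + ζ′/ζ(1/2 + y))⁻¹")] -/
def xiM (u : ℂ) : ℂ := I * logDeriv riemannXi (1 / 2 - I * u)

/-- **`(1 + Θ_ξ(u))·M(u) = i(1 − Θ_ξ(u))`** wherever `E_ξ(u) ≠ 0` and `A(u) ≠ 0` (from
`ξ′(s) = E − A`, `E♯ = 2A − E`: `M = i(E−A)/A`, `1 + Θ = 2A/E`, `1 − Θ = 2(E−A)/E`). RH-FREE.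
[cite: Suzuki2023b, §3.3 eq. (3.3) p. 7 and Prop. 3.2 proof p. 8 L40–44] -/
theorem one_add_lagariasTheta_mul_xiM {u : ℂ} (hE : lagariasE u ≠ 0) (hA : lagariasXiA u ≠ 0) :
    (1 + lagariasTheta u) * xiM u = I * (1 - lagariasTheta u) := by
  have hξ : riemannXi (1 / 2 - I * u) = lagariasXiA u := (lagariasXiA_eq u).symm
  have hEdef : lagariasE u = riemannXi (1 / 2 - I * u) + deriv riemannXi (1 / 2 - I * u) := rfl
  have hξ' : deriv riemannXi (1 / 2 - I * u) = lagariasE u - lagariasXiA u := by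
    rw [hEdef, hξ]; ring
  have hsharp : sharp lagariasE u = 2 * lagariasXiA u - lagariasE u := by
    simp only [lagariasXiA]; ring
  have hL : logDeriv riemannXi (1 / 2 - I * u) = (lagariasE u - lagariasXiA u) / lagariasXiA u := by
    rw [logDeriv_apply, hξ', hξ]
  rw [xiM, hL, lagariasTheta, hsharp]
  field_simp
  ring

/-- **`conj M(w) = M(w̄)`** (`ξ` is real on the real axis and `ξ(1 − s) = ξ(s)`: the tree's
`logDeriv_riemannXi_conj`, `logDeriv_riemannXi_one_sub`). RH-FREE.
[cite: Suzuki2023b, §3.3 p. 8 L1–2 ("by functional equations ξ(s) = ξ(1−s) and ξ(s) = conj ξ(s̄)")] -/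
theorem conj_xiM (w : ℂ) : conj (xiM w) = xiM (conj w) := by
  unfold xiM
  rw [map_mul, Complex.conj_I, ← logDeriv_riemannXi_conj]
  have e1 : conj (1 / 2 - I * w) = 1 - (1 / 2 - I * conj w) := by
    simp only [map_sub, map_div₀, map_one, map_ofNat, map_mul, Complex.conj_I]; ring
  rw [e1, logDeriv_riemannXi_one_sub]
  ring

/-- **The kernel numerator identity (under RH):** for `z, w ∈ ℂ₊`,
`(1 + Θ(z))(1 + conj Θ(w))·(M(z) − M(w̄)) = 2i(1 − Θ(z) conj Θ(w))`. RH-CONSEQUENCE (it needs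
`E, A ≠ 0` at `z, w`, i.e. RH). [cite: Suzuki2023b, Prop. 3.2 proof p. 8 L40–44; Suzuki2025WeilHilbertSpace, CJM Prop. 4.1 p. 10] -/
theorem kernel_numerator_identity (hRH : RiemannHypothesis) {z w : ℂ} (hz : 0 < z.im) (hw : 0 < w.im) :
    (1 + lagariasTheta z) * (1 + conj (lagariasTheta w)) * (xiM z - xiM (conj w)) =
      2 * I * (1 - lagariasTheta z * conj (lagariasTheta w)) := by
  have h1 := one_add_lagariasTheta_mul_xiM (lagariasE_ne_zero_of_im_pos hRH hz)
    (lagariasXiA_ne_zero_of_im_pos hRH hz)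
  have h2 := one_add_lagariasTheta_mul_xiM (lagariasE_ne_zero_of_im_pos hRH hw)
    (lagariasXiA_ne_zero_of_im_pos hRH hw)
  have h2' : (1 + conj (lagariasTheta w)) * xiM (conj w) = -I * (1 - conj (lagariasTheta w)) := by
    have := congrArg conj h2
    simp only [map_mul, map_add, map_one, map_sub, Complex.conj_I, conj_xiM] at this
    linear_combination this
  linear_combination (1 + conj (lagariasTheta w)) * h1 - (1 + lagariasTheta z) * h2'

/-- `s_u − ρ = i(γ_ρ − u)` for `s_u = ½ − iu`, `γ_ρ = i(ρ − ½)` (the dictionary `Γ ↔` zeros of `ξ`).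
RH-FREE. [cite: Suzuki2025WeilHilbertSpace, CJM §1 p. 2 ("Γ … the set of all zeros of ξ(1/2 − iz)")] -/
theorem half_sub_I_mul_sub_eq (u ρ : ℂ) : 1 / 2 - I * u - ρ = I * (suzukiZeroParam ρ - u) := by
  rw [suzukiZeroParam]
  ring_nf
  rw [Complex.I_sq]
  ring

/-- `|γ_ρ − u| = |ρ − s_u|` (`s_u = ½ − iu`). RH-FREE. [cite: Suzuki2025WeilHilbertSpace, CJM §1 p. 2] -/
theorem norm_suzukiZeroParam_sub (u ρ : ℂ) : ‖suzukiZeroParam ρ - u‖ = ‖ρ - (1 / 2 - I * u)‖ := by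
  rw [← norm_neg (ρ - _), neg_sub, half_sub_I_mul_sub_eq, norm_mul, Complex.norm_I, one_mul]

/-- **`Σ_ρ m(ρ)/|ρ − s|² < ∞` for every `s ∈ ℂ`** (over the non-trivial zeros with multiplicity;
the finitely many zeros near `s` aside, compare with the tree's absolutely convergent
`Σ m(ρ) Re 1/(s′−ρ)` at `s′ = 2 + i·Im s`). RH-FREE.
[cite: Titchmarsh1986, §9.2, Thm. 9.2 (N(T+1) − N(T) = O(log T))] -/
theorem summable_zeroOrder_div_norm_sub_sq (s : ℂ) :
    Summable fun ρ : riemannZetaNontrivialZeros ↦ (riemannZetaZeroOrder (ρ : ℂ) : ℝ) / ‖(ρ : ℂ) - s‖ ^ 2 := by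
  set s' : ℂ := 2 + s.im * I with hs'
  have hs're : s'.re = 2 := by simp [hs']
  have hs'im : s'.im = s.im := by simp [hs']
  have hζ : riemannZeta s' ≠ 0 := riemannZeta_ne_zero_of_one_lt_re (by rw [hs're]; norm_num)
  have hmain : Summable fun ρ : riemannZetaNontrivialZeros ↦
      ‖(riemannZetaZeroOrder (ρ : ℂ) : ℝ) * (1 / (s' - ρ)).re‖ :=
    summable_norm_zeroOrder_mul_re_inv_sub hζ
  -- the finite set of zeros within distance `1` of `s`
  have hfin : {ρ : riemannZetaNontrivialZeros | ‖(ρ : ℂ) - s‖ < 1}.Finite := by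
    have h := (riemannZetaNontrivialZeros_finite_inter_ball s 1).preimage
      (Subtype.val_injective (p := fun x ↦ x ∈ riemannZetaNontrivialZeros)).injOn
    refine h.subset fun ρ hρ ↦ ?_
    exact ⟨ρ.2, by simpa [Metric.mem_ball, dist_eq_norm] using hρ⟩
  rw [← hfin.summable_compl_iff]
  set C : ℝ := 1 + |s.re - 2| with hC
  have hC1 : 1 ≤ C := by rw [hC]; linarith [abs_nonneg (s.re - 2)]
  refine Summable.of_nonneg_of_le (fun ρ ↦ ?_) (fun ρ ↦ ?_)
    ((hmain.subtype _).mul_left (C ^ 2))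
  · have h := riemannZetaNontrivialZeros.one_le_order ρ.1.2
    have hm0 : (0 : ℝ) ≤ riemannZetaZeroOrder (ρ.1 : ℂ) := by exact_mod_cast zero_le_one.trans h
    exact div_nonneg hm0 (by positivity)
  -- for `‖ρ − s‖ ≥ 1`: `m/‖ρ−s‖² ≤ C²·m·Re 1/(s′−ρ)`
  obtain ⟨⟨ρ, hρZ⟩, hρ⟩ := ρ
  simp only [Set.mem_compl_iff, Set.mem_setOf_eq, not_lt] at hρ
  simp only [Function.comp_apply]
  have hm0 : (0 : ℝ) ≤ riemannZetaZeroOrder ρ := by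
    have h := riemannZetaNontrivialZeros.one_le_order hρZ
    exact_mod_cast (zero_le_one.trans h)
  have hβ : ρ.re < 1 := riemannZetaNontrivialZeros.re_lt_one hρZ
  have hne : s' - ρ ≠ 0 := fun h ↦ by
    have := congrArg Complex.re h; rw [Complex.sub_re, hs're, Complex.zero_re] at this; linarith
  have hre : (1 / (s' - ρ)).re = (2 - ρ.re) / ‖s' - ρ‖ ^ 2 := by
    rw [IsHadamardSeq.re_inv_sub_eq, hs're]
  have hpos : 0 < ‖s' - ρ‖ ^ 2 := by
    have := norm_pos_iff.2 hne
    positivity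
  have h1 : 1 / ‖s' - ρ‖ ^ 2 ≤ (1 / (s' - ρ)).re := by
    rw [hre]; exact div_le_div_of_nonneg_right (by linarith) hpos.le
  -- `‖ρ − s′‖ ≤ C‖ρ − s‖`
  have hdist : ‖s' - ρ‖ ≤ C * ‖ρ - s‖ := by
    have e : s' - ρ = (s - ρ) + (s' - s) := by ring
    have hss : ‖s' - s‖ = |s.re - 2| := by
      have : s' - s = ((2 - s.re : ℝ) : ℂ) := by
        apply Complex.ext <;> simp [hs']
      rw [this, Complex.norm_real, Real.norm_eq_abs, abs_sub_comm]
    calc ‖s' - ρ‖ ≤ ‖s - ρ‖ + ‖s' - s‖ := by rw [e]; exact norm_add_le _ _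
      _ = ‖ρ - s‖ + |s.re - 2| := by rw [norm_sub_rev, hss]
      _ ≤ ‖ρ - s‖ + |s.re - 2| * ‖ρ - s‖ := by nlinarith [abs_nonneg (s.re - 2)]
      _ = C * ‖ρ - s‖ := by rw [hC]; ring
  have hρs : 0 < ‖ρ - s‖ ^ 2 := by positivity
  have h2 : 1 / ‖ρ - s‖ ^ 2 ≤ C ^ 2 * (1 / ‖s' - ρ‖ ^ 2) := by
    rw [← div_eq_mul_one_div, div_le_div_iff₀ hρs hpos, one_mul]
    calc ‖s' - ρ‖ ^ 2 ≤ (C * ‖ρ - s‖) ^ 2 := pow_le_pow_left₀ (norm_nonneg _) hdist 2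
      _ = C ^ 2 * ‖ρ - s‖ ^ 2 := by ring
  calc (riemannZetaZeroOrder ρ : ℝ) / ‖ρ - s‖ ^ 2
      = (riemannZetaZeroOrder ρ : ℝ) * (1 / ‖ρ - s‖ ^ 2) := by rw [← div_eq_mul_one_div]
    _ ≤ (riemannZetaZeroOrder ρ : ℝ) * (C ^ 2 * (1 / (s' - ρ)).re) :=
        mul_le_mul_of_nonneg_left (h2.trans (mul_le_mul_of_nonneg_left h1 (by positivity))) hm0
    _ = C ^ 2 * ((riemannZetaZeroOrder ρ : ℝ) * (1 / (s' - ρ)).re) := by ring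
    _ ≤ C ^ 2 * ‖(riemannZetaZeroOrder ρ : ℝ) * (1 / (s' - ρ)).re‖ :=
        mul_le_mul_of_nonneg_left (Real.le_norm_self _) (by positivity)

/-- Absolute summability of the kernel-pair terms `m(ρ)/((γ_ρ − z)(γ_ρ − v))` (AM–GM and
`summable_zeroOrder_div_norm_sub_sq`). RH-FREE.
[cite: Suzuki2025WeilHilbertSpace, CJM eq. (5.3)–(5.4) p. 14 (the measure τ = Σ m_γ δ_γ)] -/
theorem summable_norm_zeroOrder_div_kernelPair (z v : ℂ) :
    Summable fun ρ : riemannZetaNontrivialZeros ↦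
      ‖(riemannZetaZeroOrder (ρ : ℂ) : ℂ) / ((suzukiZeroParam ρ - z) * (suzukiZeroParam ρ - v))‖ := by
  have h1 := summable_zeroOrder_div_norm_sub_sq (1 / 2 - I * z)
  have h2 := summable_zeroOrder_div_norm_sub_sq (1 / 2 - I * v)
  refine Summable.of_nonneg_of_le (fun _ ↦ norm_nonneg _) (fun ρ ↦ ?_)
    ((h1.add h2).mul_left (1 / 2))
  have hm0 : (0 : ℝ) ≤ riemannZetaZeroOrder (ρ : ℂ) := by
    have h := riemannZetaNontrivialZeros.one_le_order ρ.2
    exact_mod_cast (zero_le_one.trans h)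
  rw [norm_div, norm_mul, Complex.norm_intCast, norm_suzukiZeroParam_sub, norm_suzukiZeroParam_sub]
  set a : ℝ := ‖(ρ : ℂ) - (1 / 2 - I * z)‖
  set b : ℝ := ‖(ρ : ℂ) - (1 / 2 - I * v)‖
  have hm : |((riemannZetaZeroOrder (ρ : ℂ) : ℤ) : ℝ)| = (riemannZetaZeroOrder (ρ : ℂ) : ℝ) :=
    abs_of_nonneg hm0
  rw [hm]
  by_cases hab : a * b = 0
  · rw [hab, div_zero]; positivity
  have ha : 0 < a := lt_of_le_of_ne (norm_nonneg _) fun h ↦ hab (by rw [← h, zero_mul])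
  have hb : 0 < b := lt_of_le_of_ne (norm_nonneg _) fun h ↦ hab (by rw [← h, mul_zero])
  -- `1/(ab) ≤ (1/a² + 1/b²)/2`
  have key : 1 / (a * b) ≤ 1 / 2 * (1 / a ^ 2 + 1 / b ^ 2) := by
    rw [div_add_div _ _ (by positivity) (by positivity), ← mul_div_assoc, div_le_div_iff₀ (by positivity) (by positivity)]
    nlinarith [sq_nonneg (a - b), ha.le, hb.le, mul_pos ha hb]
  calc (riemannZetaZeroOrder (ρ : ℂ) : ℝ) / (a * b)
      = (riemannZetaZeroOrder (ρ : ℂ) : ℝ) * (1 / (a * b)) := by rw [← div_eq_mul_one_div]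
    _ ≤ (riemannZetaZeroOrder (ρ : ℂ) : ℝ) * (1 / 2 * (1 / a ^ 2 + 1 / b ^ 2)) :=
        mul_le_mul_of_nonneg_left key hm0
    _ = 1 / 2 * ((riemannZetaZeroOrder (ρ : ℂ) : ℝ) / a ^ 2 + (riemannZetaZeroOrder (ρ : ℂ) : ℝ) / b ^ 2) := by
        ring

/-- **The Hadamard partial fraction as a kernel expansion (RH-FREE):** for `z, v ∈ ℂ` with
`ξ(½ − iz) ≠ 0`, `ξ(½ − iv) ≠ 0`, `z ≠ v`:
`Σ_ρ m(ρ)/((γ_ρ − z)(γ_ρ − v)) = (M(z) − M(v))/(z − v)`, the sum over the non-trivial zeros with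
multiplicity, absolutely convergent. This is the tree's PROVED `ξ′/ξ(s) = Σₙ [1/(s−ρₙ) + 1/(s−(1−ρₙ))]`
(`IsHadamardSeq.logDeriv_riemannXi_eq_tsum_pairs`) differenced at two points — the pairing
`ρ ↔ 1−ρ` carries no linear term, which is the content of "`A ∉ 𝓗(E)`" in [Su23b] Prop. 3.2's
proof (de Branges' Thm. 22: no defect function). RH-FREE.
[cite: Suzuki2023b, Prop. 3.2 (proof), p. 8 ("A(z) does not belong to 𝓗(E) … by [dB68, Theorem 22]"); Suzuki2025WeilHilbertSpace, CJM eq. (5.3) p. 14] -/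
theorem hasSum_zeroOrder_div_kernelPair {z v : ℂ} (hz : riemannXi (1 / 2 - I * z) ≠ 0)
    (hv : riemannXi (1 / 2 - I * v) ≠ 0) (hzv : z ≠ v) :
    HasSum (fun ρ : riemannZetaNontrivialZeros ↦
        (riemannZetaZeroOrder (ρ : ℂ) : ℂ) / ((suzukiZeroParam ρ - z) * (suzukiZeroParam ρ - v)))
      ((xiM z - xiM v) / (z - v)) := by
  classical
  obtain ⟨b, hb⟩ := exists_isHadamardSeq 0
  set F : ℂ → ℂ := fun ρ ↦ 1 / ((suzukiZeroParam ρ - z) * (suzukiZeroParam ρ - v)) with hF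
  -- termwise: `i/(s_z − ρ) − i/(s_v − ρ) = (z − v)·F ρ` whenever `ξ(ρ) = 0`
  have hterm : ∀ ρ : ℂ, riemannXi ρ = 0 →
      I * (1 / (1 / 2 - I * z - ρ)) - I * (1 / (1 / 2 - I * v - ρ)) = (z - v) * F ρ := by
    intro ρ hρ
    have hγz : suzukiZeroParam ρ - z ≠ 0 := by
      intro h
      have e : 1 / 2 - I * z - ρ = 0 := by rw [half_sub_I_mul_sub_eq, h, mul_zero]
      exact hz (by rw [show (1 : ℂ) / 2 - I * z = ρ by linear_combination e]; exact hρ)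
    have hγv : suzukiZeroParam ρ - v ≠ 0 := by
      intro h
      have e : 1 / 2 - I * v - ρ = 0 := by rw [half_sub_I_mul_sub_eq, h, mul_zero]
      exact hv (by rw [show (1 : ℂ) / 2 - I * v = ρ by linear_combination e]; exact hρ)
    rw [half_sub_I_mul_sub_eq, half_sub_I_mul_sub_eq, hF]
    field_simp
    ring
  -- the Hadamard series at `s_z` and `s_v`
  set G : ℕ → ℂ := fun k ↦ if b k = 0 then 0 else
      (F (IsHadamardSeq.xiZero b k) + F (1 - IsHadamardSeq.xiZero b k)) with hG
  have hGsum : HasSum G ((xiM z - xiM v) / (z - v)) := by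
    have hzv' : z - v ≠ 0 := sub_ne_zero.2 hzv
    have hSz := (hb.summable_pairs hz).hasSum
    have hSv := (hb.summable_pairs hv).hasSum
    rw [← hb.logDeriv_riemannXi_eq_tsum_pairs hz] at hSz
    rw [← hb.logDeriv_riemannXi_eq_tsum_pairs hv] at hSv
    have h := ((hSz.mul_left I).sub (hSv.mul_left I)).div_const (z - v)
    have hval : (I * logDeriv riemannXi (1 / 2 - I * z) - I * logDeriv riemannXi (1 / 2 - I * v)) / (z - v)
        = (xiM z - xiM v) / (z - v) := rfl
    rw [hval] at h
    refine h.congr_fun fun k ↦ ?_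
    simp only [hG]
    split_ifs with hk
    · simp
    · have hρ0 : riemannXi (IsHadamardSeq.xiZero b k) = 0 := hb.riemannXi_xiZero hk
      have hρ1 : riemannXi (1 - IsHadamardSeq.xiZero b k) = 0 := hb.riemannXi_one_sub_xiZero hk
      have e1 := hterm _ hρ0
      have e2 := hterm _ hρ1
      rw [mul_add, mul_add, add_sub_add_comm, e1, e2, ← mul_add, mul_div_cancel_left₀ _ hzv']
  have hG0 : ∀ k, b k = 0 → G k = 0 := fun k hk ↦ by simp [hG, hk]
  -- truncations by `|Im ρ| ≤ T`
  set K : ℝ → Finset ℕ := fun T ↦ (hb.finite_setOf_abs_im_xiZero_le T).toFinset with hK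
  have hKmem : ∀ T k, k ∈ K T ↔ b k ≠ 0 ∧ |(IsHadamardSeq.xiZero b k).im| ≤ T := fun T k ↦ by
    rw [hK, Set.Finite.mem_toFinset]; rfl
  have hlim1 : Tendsto (fun T ↦ ∑ k ∈ K T, G k) atTop (𝓝 ((xiM z - xiM v) / (z - v))) :=
    IsHadamardSeq.tendsto_sum_truncation hGsum hG0 K hKmem
  have hbox : ∀ T, ∑ ρ ∈ weilZeroFinset T, (riemannZetaZeroOrder (ρ : ℂ) : ℂ) * F ρ = ∑ k ∈ K T, G k := by
    intro T
    rw [← ZetaZeroSum.finsum_mem_weilZeroIndex_eq_sum (fun ρ ↦ (riemannZetaZeroOrder ρ : ℂ) * F ρ) T,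
      ← liZeroBox_eq_weilZeroIndex, hb.finsum_liZeroBox_eq_sum F T (K T) (hKmem T)]
    refine Finset.sum_congr rfl fun k hk ↦ ?_
    simp [hG, ((hKmem T k).1 hk).1]
  -- absolute convergence over the subtype
  have hsumC : Summable fun ρ : riemannZetaNontrivialZeros ↦ (riemannZetaZeroOrder (ρ : ℂ) : ℂ) * F ρ := by
    refine .of_norm ((summable_norm_zeroOrder_div_kernelPair z v).congr fun ρ ↦ ?_)
    rw [hF]; simp only; rw [mul_one_div]
  have hlim2 : Tendsto (fun T ↦ ∑ ρ ∈ weilZeroFinset T, (riemannZetaZeroOrder (ρ : ℂ) : ℂ) * F ρ)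
      atTop (𝓝 (∑' ρ : riemannZetaNontrivialZeros, (riemannZetaZeroOrder (ρ : ℂ) : ℂ) * F ρ)) :=
    hsumC.hasSum.comp tendsto_weilZeroFinset
  have heq : (∑' ρ : riemannZetaNontrivialZeros, (riemannZetaZeroOrder (ρ : ℂ) : ℂ) * F ρ) =
      (xiM z - xiM v) / (z - v) :=
    tendsto_nhds_unique hlim2 (hlim1.congr fun T ↦ (hbox T).symm)
  have h := hsumC.hasSum
  rw [heq] at h
  refine h.congr_fun fun ρ ↦ ?_
  rw [hF]; simp only; rw [mul_one_div]


/-! ## C. The family `ψ_γ` with its half-plane values, the kernel expansion, completeness -/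

section Family

open SuzukiOrthogonalSet

/-- **The orthogonal family `{ψ_γ}_{γ∈Γ} ⊂ V(0)` under RH, with its half-plane transform
`ψ̂_γ = F_γ` on `ℂ₊`:** membership in `V(0)`, the values `ψ̂_γ(γ) = 1/√(m_γπ)`, `ψ̂_γ(γ′) = 0`,
`2π‖ψ_γ‖² = 1`, pairwise orthogonality (the cell's `suzuki2025_orthogonalSet_of_riemannHypothesis`,
rebuilt here because the expansion below needs the SAME vectors), and `ψ̂_γ(w) = F_γ(w)` for
`Im w > 0` (`ψ_γ = 𝓕⁻¹G_γ(−2π·)` with `G_γ` the continuation of `F_γ`). RH-CONSEQUENCE.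
[cite: Suzuki2025WeilHilbertSpace, CJM Prop. 4.1 p. 10 (TeX l.1120–1139), eq. (3.5) p. 9, eq. (5.11) p. 15 ("F_γ = ψ̂_γ")] -/
theorem exists_suzukiFamily (hRH : RiemannHypothesis) :
    ∃ ψb : ℂ → Lp ℂ 2 (volume : Measure ℝ),
      (∀ ρ ∈ riemannZetaNontrivialZeros, ψb ρ ∈ suzukiV 0) ∧
      (∀ ρ ∈ riemannZetaNontrivialZeros, HasHatValue (ψb ρ) (suzukiZeroParam ρ)
          (((Real.sqrt ((riemannZetaZeroOrder ρ : ℝ) * Real.pi))⁻¹ : ℝ) : ℂ)) ∧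
      (∀ ρ ∈ riemannZetaNontrivialZeros, ∀ ρ' ∈ riemannZetaNontrivialZeros,
          ρ' ≠ ρ → HasHatValue (ψb ρ) (suzukiZeroParam ρ') 0) ∧
      (∀ ρ ∈ riemannZetaNontrivialZeros, 2 * Real.pi * ‖ψb ρ‖ ^ 2 = 1) ∧
      (∀ ρ ∈ riemannZetaNontrivialZeros, ∀ ρ' ∈ riemannZetaNontrivialZeros,
          ρ' ≠ ρ → inner ℂ (ψb ρ) (ψb ρ') = 0) ∧
      (∀ ρ ∈ riemannZetaNontrivialZeros, ∀ w : ℂ, 0 < w.im →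
          upperHalfHat (ψb ρ) w = screwBasis ρ w) := by
  classical
  -- choose the continuations `G_γ` (as in the cell's `suzuki2025_orthogonalSet_of_riemannHypothesis`)
  have hex : ∀ ρ : ℂ, ρ ∈ riemannZetaNontrivialZeros → ∃ G : ℂ → ℂ,
      (∀ z : ℂ, 0 ≤ z.im → DifferentiableAt ℂ G z) ∧
        ∀ z : ℂ, lagariasE z ≠ 0 → G z =
          ((Real.sqrt ((riemannZetaZeroOrder ρ : ℝ) / Real.pi) : ℝ) : ℂ) * I *
            dslope lagariasXiA (suzukiZeroParam ρ) z / lagariasE z :=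
    fun ρ hρ ↦ exists_continuation hRH hρ
  set G : ℂ → ℂ → ℂ := fun ρ ↦ if hρ : ρ ∈ riemannZetaNontrivialZeros then (hex ρ hρ).choose
    else fun _ ↦ 0 with hGdef
  have hGd : ∀ ρ ∈ riemannZetaNontrivialZeros, ∀ z : ℂ, 0 ≤ z.im → DifferentiableAt ℂ (G ρ) z := by
    intro ρ hρ; rw [hGdef]; simp only [dif_pos hρ]; exact (hex ρ hρ).choose_spec.1
  have hGeq : ∀ ρ ∈ riemannZetaNontrivialZeros, ∀ z : ℂ, lagariasE z ≠ 0 → G ρ z =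
      ((Real.sqrt ((riemannZetaZeroOrder ρ : ℝ) / Real.pi) : ℝ) : ℂ) * I *
        dslope lagariasXiA (suzukiZeroParam ρ) z / lagariasE z := by
    intro ρ hρ; rw [hGdef]; simp only [dif_pos hρ]; exact (hex ρ hρ).choose_spec.2
  have hG2 : ∀ ρ ∈ riemannZetaNontrivialZeros,
      MemLp (fun ξ : ℝ ↦ G ρ ((-(2 * π) * ξ : ℝ) : ℂ)) 2 volume :=
    fun ρ hρ ↦ memLp_two_continuation_dilate hρ (hGd ρ hρ) (hGeq ρ hρ)
  -- the family `ψ_γ := 𝓕⁻¹(G_γ(−2π·))`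
  refine ⟨fun ρ ↦ if hρ : ρ ∈ riemannZetaNontrivialZeros then
      (𝓕⁻ ((hG2 ρ hρ).toLp _ : Lp ℂ 2 (volume : Measure ℝ)) : Lp ℂ 2 (volume : Measure ℝ)) else 0,
    ?_, ?_, ?_, ?_, ?_, ?_⟩
  · intro ρ hρ
    simp only [dif_pos hρ]
    exact fourierInv_mem_suzukiV _ hRH hρ (hGd ρ hρ) (hGeq ρ hρ)
  · intro ρ hρ
    simp only [dif_pos hρ]
    have h := hasHatValue_fourierInv (hG2 ρ hρ) hRH hρ (hGd ρ hρ) (hGeq ρ hρ) hρ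
    rwa [(continuation_apply_suzukiZeroParam hRH hρ (hGd ρ hρ) (hGeq ρ hρ)).1, one_div] at h
  · intro ρ hρ ρ' hρ' hne
    simp only [dif_pos hρ]
    have h := hasHatValue_fourierInv (hG2 ρ hρ) hRH hρ (hGd ρ hρ) (hGeq ρ hρ) hρ'
    rwa [(continuation_apply_suzukiZeroParam hRH hρ (hGd ρ hρ) (hGeq ρ hρ)).2 ρ' hρ' hne] at h
  · intro ρ hρ
    simp only [dif_pos hρ]
    exact two_pi_mul_norm_sq_fourierInv _ hRH hρ (hGeq ρ hρ)
  · intro ρ hρ ρ' hρ' hne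
    simp only [dif_pos hρ, dif_pos hρ']
    exact inner_fourierInv_fourierInv hRH hρ hρ' hne (hGeq ρ hρ) (hGeq ρ' hρ') _ _
  · intro ρ hρ w hw
    simp only [dif_pos hρ]
    rw [upperHalfHat_fourierInv _ hRH hρ (hGd ρ hρ) (hGeq ρ hρ) hw]
    refine continuation_eq_screwBasis hρ (hGeq ρ hρ) (lagariasE_ne_zero_of_im_pos hRH hw) ?_
    rintro rfl
    exact hw.ne' (suzukiZeroParam_im_eq_zero hRH hρ)

variable {ψb : ℂ → Lp ℂ 2 (volume : Measure ℝ)}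

/-- **`{f_γ := 𝖥ψ_γ}_{γ∈Γ}` is orthonormal in `L²(ℝ)`** when `2π‖ψ_γ‖² = 1` and the `ψ_γ` are
pairwise orthogonal (Plancherel `⟪𝖥ψ, 𝖥φ⟫ = 2π⟪ψ, φ⟫`). RH-FREE bookkeeping.
[cite: Suzuki2025WeilHilbertSpace, CJM eq. (5.11) p. 15 (TeX l.1700–1705: "2π‖ψ_γ‖² = ‖F_γ‖² = 1")] -/
theorem orthonormal_suzukiFourierL2_family
    (hnorm : ∀ ρ ∈ riemannZetaNontrivialZeros, 2 * Real.pi * ‖ψb ρ‖ ^ 2 = 1)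
    (horth : ∀ ρ ∈ riemannZetaNontrivialZeros, ∀ ρ' ∈ riemannZetaNontrivialZeros,
        ρ' ≠ ρ → inner ℂ (ψb ρ) (ψb ρ') = 0) :
    Orthonormal ℂ (fun ρ : riemannZetaNontrivialZeros ↦ suzukiFourierL2 (ψb ρ)) := by
  classical
  rw [orthonormal_iff_ite]
  intro ρ ρ'
  rw [inner_suzukiFourierL2]
  split_ifs with h
  · subst h
    have h1 := hnorm ρ ρ.2
    have h2 : inner ℂ (ψb ρ) (ψb ρ) = ((‖ψb ρ‖ ^ 2 : ℝ) : ℂ) := by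
      rw [inner_self_eq_norm_sq_to_K]; norm_cast
    rw [h2, ← Complex.ofReal_mul, h1, Complex.ofReal_one]
  · rw [horth ρ ρ.2 ρ' ρ'.2 (fun e ↦ h (Subtype.ext e).symm), mul_zero]

/-- The scalar bookkeeping behind the kernel expansion: with `c² = m/p`,
`c·(−iA/(2(w̄−γ))) · (2p·c·(iB/(2(u−γ)))) = ½AB · m/((γ−u)(γ−w̄))`. [folklore] -/
private theorem pairing_algebra {c m p A B u cw γ : ℂ} (hcc : c * c = m / p) (hp : p ≠ 0)
    (hu : u - γ ≠ 0) (hw : cw - γ ≠ 0) :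
    c * (-I * A / (2 * (cw - γ))) * (2 * p * (c * (I * B / (2 * (u - γ))))) =
      1 / 2 * A * B * (m / ((γ - u) * (γ - cw))) := by
  have hγu : γ - u ≠ 0 := fun h ↦ hu (by linear_combination -h)
  have hγw : γ - cw ≠ 0 := fun h ↦ hw (by linear_combination -h)
  have hm : p * (c * c) = m := by rw [hcc, mul_div_assoc', mul_div_cancel_left₀ _ hp]
  have hII : -I * I = 1 := by rw [neg_mul, Complex.I_mul_I, neg_neg]
  have h1 : c * (-I * A / (2 * (cw - γ))) * (2 * p * (c * (I * B / (2 * (u - γ))))) =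
      (-I * I) * (p * (c * c)) * (A * B) / ((2 * (cw - γ)) * (u - γ)) := by
    field_simp
  rw [h1, hII, hm, one_mul]
  field_simp
  ring

/-- **The summands of the kernel expansion, paired with a Cauchy kernel (under RH):** for `ψ ∈ V(0)`
with `ψ̂ = F_γ` on `ℂ₊` and `u, w ∈ ℂ₊`,
`⟪𝖥ψ, K_w⟫·⟪𝖥e_u, 𝖥ψ⟫ = conj F_γ(w)·2πF_γ(u) = ½(1 + conj Θ(w))(1 + Θ(u)) · m_γ/((γ−u)(γ−w̄))`
(`F_γ(z) = √(m_γ/π)·i(1+Θ(z))/(2(z−γ))`, `γ` real under RH). RH-CONSEQUENCE.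
[cite: Suzuki2025WeilHilbertSpace, CJM eq. (3.5) p. 9 and Prop. 4.1 p. 10; Suzuki2023b, Prop. 3.2 (proof) p. 8] -/
theorem inner_modelKernelVec_mul_inner_cauchyVec (hRH : RiemannHypothesis)
    {ψ : Lp ℂ 2 (volume : Measure ℝ)} {ρ : ℂ} (hρ : ρ ∈ riemannZetaNontrivialZeros)
    (hψ : ψ ∈ suzukiV 0) (hhat : ∀ w : ℂ, 0 < w.im → upperHalfHat ψ w = screwBasis ρ w)
    {u w : ℂ} (hu : 0 < u.im) (hw : 0 < w.im) :
    inner ℂ (suzukiFourierL2 ψ) (modelKernelVec w) *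
        inner ℂ (suzukiFourierL2 (cauchyVec u)) (suzukiFourierL2 ψ) =
      1 / 2 * (1 + conj (lagariasTheta w)) * (1 + lagariasTheta u) *
        ((riemannZetaZeroOrder ρ : ℂ) / ((suzukiZeroParam ρ - u) * (suzukiZeroParam ρ - conj w))) := by
  have hK : inner ℂ (suzukiFourierL2 ψ) (modelKernelVec w) = conj (screwBasis ρ w) := by
    rw [← inner_conj_symm, inner_modelKernelVec hψ hw, hhat w hw]
  have hπ : (Real.pi : ℂ) ≠ 0 := Complex.ofReal_ne_zero.2 Real.pi_ne_zero
  have hE : inner ℂ (suzukiFourierL2 (cauchyVec u)) (suzukiFourierL2 ψ) =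
      2 * Real.pi * screwBasis ρ u := by
    have h := upperHalfHat_eq_inner_fourier ψ hu
    rw [hhat u hu] at h
    rw [h]
    field_simp
  rw [hK, hE]
  have hγim : (suzukiZeroParam ρ).im = 0 := suzukiZeroParam_im_eq_zero hRH hρ
  have hγc : conj (suzukiZeroParam ρ) = suzukiZeroParam ρ := Complex.conj_eq_iff_im.2 hγim
  have hm0 : (0 : ℝ) ≤ (riemannZetaZeroOrder ρ : ℝ) / Real.pi := by
    have h1 := riemannZetaNontrivialZeros.one_le_order hρ
    have h' : (0 : ℝ) ≤ (riemannZetaZeroOrder ρ : ℝ) := by exact_mod_cast zero_le_one.trans h1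
    positivity
  have hcc : ((Real.sqrt ((riemannZetaZeroOrder ρ : ℝ) / Real.pi) : ℝ) : ℂ) *
      ((Real.sqrt ((riemannZetaZeroOrder ρ : ℝ) / Real.pi) : ℝ) : ℂ) =
        (riemannZetaZeroOrder ρ : ℂ) / Real.pi := by
    rw [← Complex.ofReal_mul, Real.mul_self_sqrt hm0]
    push_cast
    ring
  have huγ : u - suzukiZeroParam ρ ≠ 0 := by
    intro h
    have := congrArg Complex.im h
    rw [Complex.sub_im, hγim, Complex.zero_im] at this
    linarith
  have hwγ : conj w - suzukiZeroParam ρ ≠ 0 := by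
    intro h
    have := congrArg Complex.im h
    rw [Complex.sub_im, Complex.conj_im, hγim, Complex.zero_im] at this
    linarith
  simp only [screwBasis, map_mul, map_div₀, map_add, map_one, map_sub, Complex.conj_ofReal,
    Complex.conj_I, map_ofNat, hγc]
  exact pairing_algebra hcc hπ huγ hwγ

/-- **The kernel expansion `K_w = Σ_γ conj F_γ(w)·f_γ` — `K_w ∈ closure span{𝖥ψ_γ}` (under RH).**
For `w ∈ ℂ₊` the model-space kernel vector `K_w` lies in the closed span `W` of the orthonormal
family `f_γ = 𝖥ψ_γ`: the orthogonal projection `P_W K_w = Σ_γ ⟪f_γ, K_w⟫f_γ` has the same pairings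
with every Cauchy kernel `𝖥e_u` (`u ∈ ℂ₊`) as `K_w`, because
`Σ_γ m_γ/((γ−u)(γ−w̄)) = (M(u) − M(w̄))/(u − w̄)` (the Hadamard partial fraction for `ξ′/ξ`, no term at
infinity — de Branges' Thm. 22 "`A ∉ 𝓗(E)`" in [Su23b]) and
`(1+Θ(u))(1+conj Θ(w))(M(u)−M(w̄)) = 2i(1 − Θ(u)conj Θ(w))`; and `K_w − P_W K_w ∈ H²` is determined by
those pairings. This is the printed "`{F_γ}` is an orthonormal basis of `𝒦(Θ)`" ([Su25c] Prop. 4.1 =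
[Su23b] Prop. 3.2, via de Branges Thm. 22) in reproducing-kernel form. RH-CONSEQUENCE.
[cite: Suzuki2025WeilHilbertSpace, CJM Prop. 4.1 p. 10 (TeX l.1120–1142); Suzuki2023b, Prop. 3.2 (proof) p. 8] -/
theorem modelKernelVec_mem_topologicalClosure_span (hRH : RiemannHypothesis)
    (hV : ∀ ρ ∈ riemannZetaNontrivialZeros, ψb ρ ∈ suzukiV 0)
    (hnorm : ∀ ρ ∈ riemannZetaNontrivialZeros, 2 * Real.pi * ‖ψb ρ‖ ^ 2 = 1)
    (horth : ∀ ρ ∈ riemannZetaNontrivialZeros, ∀ ρ' ∈ riemannZetaNontrivialZeros,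
        ρ' ≠ ρ → inner ℂ (ψb ρ) (ψb ρ') = 0)
    (hhat : ∀ ρ ∈ riemannZetaNontrivialZeros, ∀ w : ℂ, 0 < w.im →
        upperHalfHat (ψb ρ) w = screwBasis ρ w)
    {w : ℂ} (hw : 0 < w.im) :
    modelKernelVec w ∈ (Submodule.span ℂ
      (Set.range fun ρ : riemannZetaNontrivialZeros ↦ suzukiFourierL2 (ψb ρ))).topologicalClosure := by
  classical
  set f : riemannZetaNontrivialZeros → Lp ℂ 2 (volume : Measure ℝ) :=
    fun ρ ↦ suzukiFourierL2 (ψb ρ) with hf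
  have hfo : Orthonormal ℂ f := orthonormal_suzukiFourierL2_family hnorm horth
  set W : Submodule ℂ (Lp ℂ 2 (volume : Measure ℝ)) :=
    (Submodule.span ℂ (Set.range f)).topologicalClosure with hW
  haveI : CompleteSpace W := (Submodule.isClosed_topologicalClosure _).completeSpace_coe
  have hfmem : ∀ ρ, f ρ ∈ W := fun ρ ↦
    (Submodule.span ℂ (Set.range f)).le_topologicalClosure (Submodule.subset_span ⟨ρ, rfl⟩)
  -- the family inside `W` is a Hilbert basis of `W`
  set fW : riemannZetaNontrivialZeros → W := fun ρ ↦ ⟨f ρ, hfmem ρ⟩ with hfW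
  have hfWo : Orthonormal ℂ fW := by
    rw [orthonormal_iff_ite] at hfo ⊢
    intro i j
    rw [Submodule.coe_inner]
    exact hfo i j
  have hsp : (Submodule.span ℂ (Set.range fW))ᗮ = ⊥ := by
    rw [Submodule.eq_bot_iff]
    intro x hx
    have h1 : ∀ ρ, inner ℂ (f ρ) (x : Lp ℂ 2 (volume : Measure ℝ)) = 0 := fun ρ ↦ by
      have := (Submodule.mem_orthogonal _ _).1 hx (fW ρ) (Submodule.subset_span ⟨ρ, rfl⟩)
      rwa [Submodule.coe_inner] at this
    have h2 : (x : Lp ℂ 2 (volume : Measure ℝ)) ∈ (Submodule.span ℂ (Set.range f))ᗮ := by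
      have hle : Submodule.span ℂ (Set.range f) ≤
          (Submodule.span ℂ {(x : Lp ℂ 2 (volume : Measure ℝ))})ᗮ := by
        refine Submodule.span_le.2 ?_
        rintro _ ⟨ρ, rfl⟩
        exact Submodule.mem_orthogonal_singleton_iff_inner_left.2 (h1 ρ)
      exact (Submodule.mem_orthogonal _ _).2 fun u hu ↦
        Submodule.mem_orthogonal_singleton_iff_inner_left.1 (hle hu)
    have h3 : (x : Lp ℂ 2 (volume : Measure ℝ)) ∈ Wᗮ :=
      (Submodule.orthogonal_closure (Submodule.span ℂ (Set.range f))).ge h2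
    have h4 := Submodule.inner_right_of_mem_orthogonal x.2 h3
    exact (Submodule.coe_eq_zero).1 (inner_self_eq_zero.1 h4)
  set b := HilbertBasis.mkOfOrthogonalEqBot hfWo hsp with hb
  have hbρ : ∀ ρ, b ρ = fW ρ := fun ρ ↦ by rw [hb, HilbertBasis.coe_mkOfOrthogonalEqBot]
  -- the projection of `K_w` onto `W` and its expansion
  set PK : W := W.orthogonalProjectionOnto (modelKernelVec w) with hPK
  have hrepr : ∀ ρ, b.repr PK ρ = inner ℂ (f ρ) (modelKernelVec w) := fun ρ ↦ by
    rw [b.repr_apply_apply, hbρ ρ, hPK, Submodule.inner_orthogonalProjectionOnto_eq_of_mem_left]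
  have hsumE : HasSum (fun ρ : riemannZetaNontrivialZeros ↦
      (inner ℂ (f ρ) (modelKernelVec w)) • f ρ) (PK : Lp ℂ 2 (volume : Measure ℝ)) := by
    refine ((b.hasSum_repr PK).mapL W.subtypeL).congr_fun fun ρ ↦ ?_
    rw [ContinuousLinearMap.map_smul, Submodule.subtypeL_apply, hrepr ρ, hbρ ρ]
  -- `P_W K_w` and `K_w` have the same pairings with the Cauchy kernels
  have hpair : ∀ u : ℂ, 0 < u.im →
      inner ℂ (suzukiFourierL2 (cauchyVec u)) (PK : Lp ℂ 2 (volume : Measure ℝ)) =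
        inner ℂ (suzukiFourierL2 (cauchyVec u)) (modelKernelVec w) := by
    intro u hu
    have h1 : HasSum (fun ρ : riemannZetaNontrivialZeros ↦
        inner ℂ (f ρ) (modelKernelVec w) * inner ℂ (suzukiFourierL2 (cauchyVec u)) (f ρ))
        (inner ℂ (suzukiFourierL2 (cauchyVec u)) (PK : Lp ℂ 2 (volume : Measure ℝ))) := by
      refine (hsumE.mapL (innerSL ℂ (suzukiFourierL2 (cauchyVec u)))).congr_fun fun ρ ↦ ?_
      rw [innerSL_apply_apply, inner_smul_right]
    set cΘ : ℂ := 1 / 2 * (1 + conj (lagariasTheta w)) * (1 + lagariasTheta u) with hcΘ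
    have h2 : ∀ ρ : riemannZetaNontrivialZeros,
        inner ℂ (f ρ) (modelKernelVec w) * inner ℂ (suzukiFourierL2 (cauchyVec u)) (f ρ) =
          cΘ * ((riemannZetaZeroOrder (ρ : ℂ) : ℂ) /
            ((suzukiZeroParam ρ - u) * (suzukiZeroParam ρ - conj w))) := fun ρ ↦
      inner_modelKernelVec_mul_inner_cauchyVec hRH ρ.2 (hV ρ ρ.2) (hhat ρ ρ.2) hu hw
    have hxi_u : riemannXi (1 / 2 - I * u) ≠ 0 := by
      rw [← lagariasXiA_eq]; exact lagariasXiA_ne_zero_of_im_pos hRH hu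
    have hxi_w : riemannXi (1 / 2 - I * conj w) ≠ 0 := by
      refine SondowDumitrescu2010.riemannXi_ne_zero_of_RH hRH ?_
      simp only [Complex.sub_re, Complex.mul_re, Complex.I_re, Complex.I_im, Complex.conj_re,
        Complex.conj_im, one_div]
      norm_num
      linarith
    have hne : u ≠ conj w := fun h ↦ by
      have := congrArg Complex.im h
      rw [Complex.conj_im] at this
      linarith
    have h3 := ((hasSum_zeroOrder_div_kernelPair hxi_u hxi_w hne).mul_left cΘ).congr_fun h2
    rw [h1.unique h3, inner_fourier_cauchyVec_modelKernelVec hRH hu hw, hcΘ,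
      show 1 / 2 * (1 + conj (lagariasTheta w)) * (1 + lagariasTheta u) *
          ((xiM u - xiM (conj w)) / (u - conj w)) =
        1 / 2 * ((1 + lagariasTheta u) * (1 + conj (lagariasTheta w)) * (xiM u - xiM (conj w))) /
          (u - conj w) by ring, kernel_numerator_identity hRH hu hw]
    ring
  -- `K_w − P_W K_w ∈ H²` has vanishing pairings with every Cauchy kernel, hence vanishes
  have hWle : W ≤ hardyL2Submodule := by
    rw [hW, ← hardyL2Submodule_topologicalClosure]
    refine Submodule.topologicalClosure_mono (Submodule.span_le.2 ?_)
    rintro _ ⟨ρ, rfl⟩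
    exact (suzukiFourierL2_mem_hardyL2_iff (ψb ρ)).2 (mem_suzukiV_iff.1 (hV ρ ρ.2)).1
  have hD : modelKernelVec w - (PK : Lp ℂ 2 (volume : Measure ℝ)) = 0 := by
    refine eq_zero_of_inner_fourier_cauchyVec_eq_zero
      (mem_hardyL2Submodule.1 (hardyL2Submodule.sub_mem
        (mem_hardyL2Submodule.2 (modelKernelVec_mem_hardyL2 hRH hw)) (hWle PK.2))) fun u hu ↦ ?_
    rw [inner_sub_right, hpair u hu, sub_self]
  rw [sub_eq_zero] at hD
  rw [hD]
  exact PK.2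

/-- **Completeness of `{ψ_γ}_{γ∈Γ}` in `V(0)` (under RH):** if `ψ ∈ V(0)` is orthogonal to every
`ψ_γ`, then `ψ = 0` — `𝖥ψ ⊥ f_γ` for all `γ`, so `𝖥ψ ⊥ K_w` for every `w ∈ ℂ₊` by the kernel
expansion, i.e. `ψ̂(w) = ⟪K_w, 𝖥ψ⟫ = 0` on `ℂ₊`, and the half-plane transform is injective on
`L²(0,∞)`. The printed "`{ψ_γ}` forms an orthogonal BASIS of `V(0)`". RH-CONSEQUENCE.
[cite: Suzuki2025WeilHilbertSpace, CJM eq. (5.11) p. 15 (TeX l.1700–1705) and Prop. 4.1 p. 10] -/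
theorem eq_zero_of_forall_inner_family_eq_zero (hRH : RiemannHypothesis)
    (hV : ∀ ρ ∈ riemannZetaNontrivialZeros, ψb ρ ∈ suzukiV 0)
    (hnorm : ∀ ρ ∈ riemannZetaNontrivialZeros, 2 * Real.pi * ‖ψb ρ‖ ^ 2 = 1)
    (horth : ∀ ρ ∈ riemannZetaNontrivialZeros, ∀ ρ' ∈ riemannZetaNontrivialZeros,
        ρ' ≠ ρ → inner ℂ (ψb ρ) (ψb ρ') = 0)
    (hhat : ∀ ρ ∈ riemannZetaNontrivialZeros, ∀ w : ℂ, 0 < w.im →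
        upperHalfHat (ψb ρ) w = screwBasis ρ w)
    {ψ : Lp ℂ 2 (volume : Measure ℝ)} (hψ : ψ ∈ suzukiV 0)
    (h0 : ∀ ρ ∈ riemannZetaNontrivialZeros, inner ℂ (ψb ρ) ψ = 0) : ψ = 0 := by
  have hF0 : ∀ ρ : riemannZetaNontrivialZeros,
      inner ℂ (suzukiFourierL2 (ψb ρ)) (suzukiFourierL2 ψ) = 0 := fun ρ ↦ by
    rw [inner_suzukiFourierL2, h0 ρ ρ.2, mul_zero]
  have hle : (Submodule.span ℂ
      (Set.range fun ρ : riemannZetaNontrivialZeros ↦ suzukiFourierL2 (ψb ρ))).topologicalClosure ≤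
        (Submodule.span ℂ {suzukiFourierL2 ψ})ᗮ := by
    refine Submodule.topologicalClosure_minimal _ (Submodule.span_le.2 ?_)
      (Submodule.isClosed_orthogonal _)
    rintro _ ⟨ρ, rfl⟩
    exact Submodule.mem_orthogonal_singleton_iff_inner_left.2 (hF0 ρ)
  have hhat0 : ∀ w : ℂ, 0 < w.im → upperHalfHat ψ w = 0 := fun w hw ↦ by
    rw [← inner_modelKernelVec hψ hw]
    exact Submodule.mem_orthogonal_singleton_iff_inner_left.1
      (hle (modelKernelVec_mem_topologicalClosure_span hRH hV hnorm horth hhat hw))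
  exact eq_zero_of_upperHalfHat_eq_zero (mem_suzukiV_iff.1 hψ).1 hhat0

end Family

/-! ## D. The discharges -/

/-- **Discharge of `Suzuki2025_orthogonalBasis` (CJM Prop. 4.1 / (5.11)):** under RH the family
`{ψ_γ}_{γ∈Γ}`, `ψ_γ = 𝓕⁻¹G_γ(−2π·)`, is an orthogonal basis of `V(0)` with the printed values and
norms — clauses 1–5 from the cell's construction, completeness (clause 6) by the kernel expansion
above. RH-CONSEQUENCE, PROVED (no named fact remains in the `t = 0` norm-identity chain).
[cite: Suzuki2025WeilHilbertSpace, CJM Prop. 4.1 p. 10 (TeX l.1120–1142) and eq. (5.11) p. 15 (TeX l.1700–1705)] -/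
theorem Suzuki2025_orthogonalBasis_holds : Suzuki2025_orthogonalBasis := fun hRH ↦ by
  obtain ⟨ψb, hV, hval, hvan, hnorm, horth, hhat⟩ := exists_suzukiFamily hRH
  exact ⟨ψb, hV, hval, hvan, hnorm, horth, fun ψ hψ h0 ↦
    eq_zero_of_forall_inner_family_eq_zero hRH hV hnorm horth hhat hψ h0⟩

/-- **Discharge of `Suzuki2025_thm55_normIdentity` (CJM Thm. 5.5 (1), the case `t = 0`):** under RH,
for every `ψ ∈ V(0)`, `Σ_γ m_γ c_ψ(γ) conj c_ψ(γ̄) = 2‖ψ‖²` — from the orthogonal basis (this file) and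
the cell's `Suzuki2025_thm55_normIdentity_of_orthogonalBasis` (evaluation of `c_ψ(γ)` as the
boundary pairing `⟪K_γ, 𝖥ψ⟫`, Parseval). RH-CONSEQUENCE, PROVED.
[cite: Suzuki2025WeilHilbertSpace, CJM Thm. 5.5 (1) p. 15 (TeX l.1676–1757)] -/
theorem Suzuki2025_thm55_normIdentity_holds : Suzuki2025_thm55_normIdentity :=
  Suzuki2025_thm55_normIdentity_of_orthogonalBasis Suzuki2025_orthogonalBasis_holds

/-! ## E. CJM Lemma 5.3: `V(0) ≅ L²(τ)` — discharge of `Suzuki2025_lemma53` -/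

section Lemma53

/-- `½ − iγ_ρ = ρ` (the dictionary `Γ ↔` zeros of `ξ`, inverted). RH-FREE.
[cite: Suzuki2025WeilHilbertSpace, CJM §1 p. 2 ("Γ … the set of all zeros of ξ(1/2 − iz)")] -/
theorem half_sub_I_mul_suzukiZeroParam (ρ : ℂ) : 1 / 2 - I * suzukiZeroParam ρ = ρ := by
  have h := half_sub_I_mul_sub_eq (suzukiZeroParam ρ) ρ
  rwa [sub_self, mul_zero, sub_eq_zero] at h

/-- **CJM Lemma 5.3, clause (a) (under RH): every `ψ ∈ V(0)` has a value `ψ̂(γ)` at every `γ ∈ Γ`**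
(`S_ψ = (ψ̂(γ))_γ` is defined) — the boundary pairing `⟪K_γ, 𝖥ψ⟫`. RH-CONSEQUENCE.
[cite: Suzuki2025WeilHilbertSpace, CJM Lemma 5.3 p. 14 (TeX l.1545–1558: "S_ψ := (ψ̂(γ))_{γ∈Γ}")] -/
theorem exists_hatValues_of_mem_suzukiV (hRH : RiemannHypothesis) {ψ : Lp ℂ 2 (volume : Measure ℝ)}
    (hψ : ψ ∈ suzukiV 0) :
    ∃ c : ℂ → ℂ, ∀ ρ ∈ riemannZetaNontrivialZeros,
      HasHatValue ψ (suzukiZeroParam ρ) (c (suzukiZeroParam ρ)) := by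
  refine ⟨fun z ↦ inner ℂ (modelKernelVecReal (1 / 2 - I * z)) (suzukiFourierL2 ψ), fun ρ hρ ↦ ?_⟩
  simp only [half_sub_I_mul_suzukiZeroParam]
  exact hasHatValue_inner_modelKernelVecReal hRH hρ hψ

/-- **CJM Lemma 5.3, clause (b) = eq. (5.5) (under RH): `Σ_γ m_γ|ψ̂(γ)|² = 2‖ψ‖²` for `ψ ∈ V(0)`**
and every compatible value assignment (Thm. 5.5 (1) with `γ̄ = γ` under RH). RH-CONSEQUENCE.
[cite: Suzuki2025WeilHilbertSpace, CJM Lemma 5.3 p. 14, eq. (5.4)–(5.5) ("2‖ψ‖² = ‖S_ψ‖²_{L²(τ)}")] -/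
theorem hasSum_zeroOrder_mul_norm_sq_hatValue (hRH : RiemannHypothesis)
    {ψ : Lp ℂ 2 (volume : Measure ℝ)} (hψ : ψ ∈ suzukiV 0) {c : ℂ → ℂ}
    (hc : ∀ ρ ∈ riemannZetaNontrivialZeros, HasHatValue ψ (suzukiZeroParam ρ) (c (suzukiZeroParam ρ))) :
    HasSum (fun ρ : riemannZetaNontrivialZeros ↦
      (riemannZetaZeroOrder (ρ : ℂ) : ℝ) * ‖c (suzukiZeroParam ρ)‖ ^ 2) (2 * ‖ψ‖ ^ 2) := by
  have h := Suzuki2025_thm55_normIdentity_holds hRH ψ hψ c hc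
  have h2 : HasSum (fun ρ : riemannZetaNontrivialZeros ↦
      (((riemannZetaZeroOrder (ρ : ℂ) : ℝ) * ‖c (suzukiZeroParam ρ)‖ ^ 2 : ℝ) : ℂ))
      ((2 * ‖ψ‖ ^ 2 : ℝ) : ℂ) := by
    refine h.congr_fun fun ρ ↦ ?_
    have hγ : conj (suzukiZeroParam ρ) = suzukiZeroParam ρ :=
      Complex.conj_eq_iff_im.2 (suzukiZeroParam_im_eq_zero hRH ρ.2)
    rw [hγ, mul_assoc, Complex.mul_conj, Complex.normSq_eq_norm_sq]
    push_cast
    ring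
  exact Complex.hasSum_ofReal.1 h2

/-- **CJM Lemma 5.3, clause (c) (under RH): surjectivity of `ψ ↦ S_ψ` onto `L²(τ)`** — every `S` with
`Σ_γ m_γ|S(γ)|² < ∞` is `(ψ̂(γ))_γ` for some `ψ ∈ V(0)`, namely the orthogonal expansion
`ψ = Σ_γ S(γ)√(m_γπ)·ψ_γ` (convergent in the closed subspace `V(0)` because `2π‖ψ_γ‖² = 1` and the
`ψ_γ` are orthogonal), whose value at `γ` is read off termwise by the continuity of `ψ ↦ ⟪K_γ, 𝖥ψ⟫`
and `ψ̂_γ(γ) = 1/√(m_γπ)`, `ψ̂_γ(γ′) = 0`. RH-CONSEQUENCE.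
[cite: Suzuki2025WeilHilbertSpace, CJM Lemma 5.3 p. 14 (TeX l.1545–1558: "V(0) and L²(τ) are isomorphic") and eq. (5.11) p. 15] -/
theorem exists_mem_suzukiV_hasHatValues (hRH : RiemannHypothesis) {S : ℂ → ℂ}
    (hS : Summable fun ρ : riemannZetaNontrivialZeros ↦
      (riemannZetaZeroOrder (ρ : ℂ) : ℝ) * ‖S (suzukiZeroParam ρ)‖ ^ 2) :
    ∃ ψ ∈ suzukiV 0, ∀ ρ ∈ riemannZetaNontrivialZeros,
      HasHatValue ψ (suzukiZeroParam ρ) (S (suzukiZeroParam ρ)) := by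
  classical
  obtain ⟨ψb, hV, hval, hvan, hnorm, horth, -⟩ := exists_suzukiFamily hRH
  set K : Submodule ℂ (Lp ℂ 2 (volume : Measure ℝ)) := suzukiVSubmodule 0 with hK
  haveI : CompleteSpace K := completeSpace_suzukiVSubmodule 0
  set c₀ : ℝ := Real.sqrt (2 * Real.pi) with hc₀
  -- the orthonormal family `e_ρ := √(2π)·ψ_ρ` inside the Hilbert space `K = V(0)`
  set e : riemannZetaNontrivialZeros → K :=
    fun ρ ↦ ⟨(c₀ : ℂ) • ψb ρ, K.smul_mem _ (hV ρ ρ.2)⟩ with he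
  have heo : Orthonormal ℂ e := by
    rw [orthonormal_iff_ite]
    intro ρ ρ'
    rw [Submodule.coe_inner]
    change inner ℂ ((c₀ : ℂ) • ψb ρ) ((c₀ : ℂ) • ψb ρ') = if ρ = ρ' then (1 : ℂ) else 0
    rw [inner_smul_left, inner_smul_right, Complex.conj_ofReal]
    split_ifs with h
    · subst h
      have h1 := hnorm ρ ρ.2
      have h2 : inner ℂ (ψb ρ) (ψb ρ) = ((‖ψb ρ‖ ^ 2 : ℝ) : ℂ) := by
        rw [inner_self_eq_norm_sq_to_K]; norm_cast
      rw [h2, ← mul_assoc, ← Complex.ofReal_mul, hc₀, Real.mul_self_sqrt Real.two_pi_pos.le,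
        ← Complex.ofReal_mul, h1, Complex.ofReal_one]
    · rw [horth ρ ρ.2 ρ' ρ'.2 (fun e' ↦ h (Subtype.ext e').symm), mul_zero, mul_zero]
  -- the coefficients `d_ρ := S(γ_ρ)√(m_ρ/2)` are square-summable
  set d : riemannZetaNontrivialZeros → ℂ := fun ρ ↦ S (suzukiZeroParam ρ) *
      ((Real.sqrt ((riemannZetaZeroOrder (ρ : ℂ) : ℝ) / 2) : ℝ) : ℂ) with hd
  have hd2 : Summable fun ρ : riemannZetaNontrivialZeros ↦ ‖d ρ‖ ^ 2 := by
    refine (hS.mul_left (1 / 2)).congr fun ρ ↦ ?_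
    have hm : (0 : ℝ) ≤ (riemannZetaZeroOrder (ρ : ℂ) : ℝ) / 2 := by
      have h1 := riemannZetaNontrivialZeros.one_le_order ρ.2
      have h' : (0 : ℝ) ≤ (riemannZetaZeroOrder (ρ : ℂ) : ℝ) := by
        exact_mod_cast zero_le_one.trans h1
      positivity
    rw [hd]
    simp only
    rw [norm_mul, mul_pow, Complex.norm_real, Real.norm_of_nonneg (Real.sqrt_nonneg _),
      Real.sq_sqrt hm]
    ring
  have hsum : Summable fun ρ : riemannZetaNontrivialZeros ↦ d ρ • e ρ :=
    (heo.orthogonalFamily.summable_iff_norm_sq_summable d).2 hd2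
  set ψK : K := ∑' ρ : riemannZetaNontrivialZeros, d ρ • e ρ with hψK
  have hψsum : HasSum (fun ρ : riemannZetaNontrivialZeros ↦ d ρ • e ρ) ψK := hsum.hasSum
  refine ⟨(ψK : Lp ℂ 2 (volume : Measure ℝ)), ψK.2, fun ρ₀ hρ₀ ↦ ?_⟩
  -- the value at `γ₀` is `⟪K_{γ₀}, 𝖥ψ⟫`, a continuous linear functional of `ψ`, read off termwise
  have hv := hasHatValue_inner_modelKernelVecReal hRH hρ₀ ψK.2
  set L : K →L[ℂ] ℂ :=
    (innerSL ℂ (modelKernelVecReal ρ₀)).comp (suzukiFourierL2CLM.comp K.subtypeL) with hL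
  have hLapply : ∀ x : K, L x =
      inner ℂ (modelKernelVecReal ρ₀) (suzukiFourierL2 (x : Lp ℂ 2 (volume : Measure ℝ))) :=
    fun x ↦ rfl
  have hLe : ∀ ρ : riemannZetaNontrivialZeros, L (e ρ) =
      (c₀ : ℂ) * inner ℂ (modelKernelVecReal ρ₀) (suzukiFourierL2 (ψb ρ)) := by
    intro ρ
    rw [hLapply]
    change inner ℂ (modelKernelVecReal ρ₀) (suzukiFourierL2 ((c₀ : ℂ) • ψb ρ)) = _
    rw [suzukiFourierL2_smul, inner_smul_right]
  have hval₀ : inner ℂ (modelKernelVecReal ρ₀) (suzukiFourierL2 (ψb ρ₀)) =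
      (((Real.sqrt ((riemannZetaZeroOrder ρ₀ : ℝ) * Real.pi))⁻¹ : ℝ) : ℂ) :=
    (HasHatValue.eq_inner_modelKernelVecReal hRH hρ₀ (hV ρ₀ hρ₀) (hval ρ₀ hρ₀)).symm
  have hval' : ∀ ρ : riemannZetaNontrivialZeros, (ρ : ℂ) ≠ ρ₀ →
      inner ℂ (modelKernelVecReal ρ₀) (suzukiFourierL2 (ψb ρ)) = 0 := fun ρ hne ↦
    (HasHatValue.eq_inner_modelKernelVecReal hRH hρ₀ (hV ρ ρ.2) (hvan ρ ρ.2 ρ₀ hρ₀ hne.symm)).symm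
  have h1 : HasSum (fun ρ : riemannZetaNontrivialZeros ↦ L (d ρ • e ρ)) (L ψK) := hψsum.mapL L
  have hterm : ∀ ρ : riemannZetaNontrivialZeros, L (d ρ • e ρ) =
      d ρ * ((c₀ : ℂ) * inner ℂ (modelKernelVecReal ρ₀) (suzukiFourierL2 (ψb ρ))) := fun ρ ↦ by
    rw [map_smul, smul_eq_mul, hLe]
  have h2 : HasSum (fun ρ : riemannZetaNontrivialZeros ↦ L (d ρ • e ρ))
      (L (d ⟨ρ₀, hρ₀⟩ • e ⟨ρ₀, hρ₀⟩)) := by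
    refine hasSum_single (⟨ρ₀, hρ₀⟩ : riemannZetaNontrivialZeros) fun ρ hρ ↦ ?_
    rw [hterm, hval' ρ (fun h ↦ hρ (Subtype.ext h)), mul_zero, mul_zero]
  have hm₀ : (0 : ℝ) < (riemannZetaZeroOrder ρ₀ : ℝ) := by
    exact_mod_cast zero_lt_one.trans_le (riemannZetaNontrivialZeros.one_le_order hρ₀)
  have hreal : Real.sqrt ((riemannZetaZeroOrder ρ₀ : ℝ) / 2) *
      (c₀ * (Real.sqrt ((riemannZetaZeroOrder ρ₀ : ℝ) * Real.pi))⁻¹) = 1 := by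
    rw [hc₀, ← mul_assoc,
      ← Real.sqrt_mul (by positivity : (0 : ℝ) ≤ (riemannZetaZeroOrder ρ₀ : ℝ) / 2),
      show (riemannZetaZeroOrder ρ₀ : ℝ) / 2 * (2 * Real.pi) = (riemannZetaZeroOrder ρ₀ : ℝ) * Real.pi
        by ring,
      mul_inv_cancel₀ (Real.sqrt_pos.2 (by positivity)).ne']
  have hLψ : L ψK = S (suzukiZeroParam ρ₀) := by
    rw [h1.unique h2, hterm, hval₀, hd]
    simp only
    calc S (suzukiZeroParam ρ₀) * ((Real.sqrt ((riemannZetaZeroOrder ρ₀ : ℝ) / 2) : ℝ) : ℂ) *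
          ((c₀ : ℂ) * (((Real.sqrt ((riemannZetaZeroOrder ρ₀ : ℝ) * Real.pi))⁻¹ : ℝ) : ℂ))
        = S (suzukiZeroParam ρ₀) * ((Real.sqrt ((riemannZetaZeroOrder ρ₀ : ℝ) / 2) *
            (c₀ * (Real.sqrt ((riemannZetaZeroOrder ρ₀ : ℝ) * Real.pi))⁻¹) : ℝ) : ℂ) := by
          push_cast; ring
      _ = S (suzukiZeroParam ρ₀) := by rw [hreal, Complex.ofReal_one, mul_one]
  rw [hLapply] at hLψ
  rwa [hLψ] at hv

/-- **Discharge of `Suzuki2025_lemma53` (CJM Lemma 5.3: `V(0) ≅ L²(τ)` by `ψ ↦ S_ψ = (ψ̂(γ))_γ`, with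
`2‖ψ‖² = ‖S_ψ‖²_{L²(τ)}`):** values exist (boundary pairings `⟪K_γ, 𝖥ψ⟫`), the isometry (5.5)
(Thm. 5.5 (1) with `γ` real), and surjectivity (orthogonal expansion along the basis `ψ_γ`).
RH-CONSEQUENCE, PROVED. [cite: Suzuki2025WeilHilbertSpace, CJM Lemma 5.3 p. 14 (TeX l.1545–1558), eq. (5.4)–(5.5), (5.11)] -/
theorem Suzuki2025_lemma53_holds : Suzuki2025_lemma53 := fun hRH ↦
  ⟨fun _ hψ ↦ exists_hatValues_of_mem_suzukiV hRH hψ,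
    fun _ hψ _ hc ↦ hasSum_zeroOrder_mul_norm_sq_hatValue hRH hψ hc,
    fun _ hS ↦ exists_mem_suzukiV_hasHatValues hRH hS⟩

end Lemma53

end Literature.NumberTheory.LFunctions

end
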